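import Summits.Langlands.Langlands.Theses.RuelleTorsionArtinWeight
import Summits.Langlands.Langlands.Theorems.ParityBlindBianchiArtinWeightRealisationLevelOddTwistSector
import Literature.NumberTheory.Automorphic.StrongArtinGL2
import Literature.NumberTheory.Automorphic.OddArtinWeightOne
import Literature.NumberTheory.Automorphic.BookerStrongArtin
import Literature.NumberTheory.Automorphic.BaseChangeCyclicCuspidal
import HarnessLib

/-!
# Birth skeleton (BC3) for crux stmt-Langlands-11057
`Summit.Langlands.Langlands.Theses.RuelleTorsionArtinWeight.ArtinWeightRealisation` (R) — line `birth`

Route `route-Langlands-RuelleTorsionArtinWeight` (rev 3; deciding theorem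
`closes (hocc : ArtinPointsBianchi) (hcls : ArtinWeightRealisation) (hJ : ImQuadArtinJunction) : Langlands`).
The crux R, rank 4, "realisation at the Artin weight": for `K` imaginary quadratic, any prime `p`,
`ι : ℚ̄_p ≃+* ℂ` and any irreducible finite-image `σ : Γ_K → GL₂(ℚ̄_p)` that is `p`-ADICALLY AUTOMORPHIC of some
`S`-good tame level (an `𝒪_{ℚ̄_p}`-valued point of `Spf 𝕋(U^p)` of the `p`-power tower, generic `IsHeckePoint`,
Hansen-associated with `σ` at every `v ∉ S`, `FramedGaloisRep.IsHeckeAssociatedAt`), some cuspidal `π` of `GL₂(𝔸_K)` is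
Satake–Frobenius compatible with `σ` at almost every place.  Grounded/checked OPEN-PROBLEM (the non-regular-weight wall
over a field with a complex place, `Literature.Barriers.Langlands.NonRegularWeightBarrier`); shared fate with the sibling
crux R′ = `ParityBlindBianchi.ArtinWeightRealisationLevel` (stmt-Langlands-15111; `R′ → R` unconditional, `R′ ↔ R`
modulo the twisted Hecke theory of `GL(2)`, landed p108329 / p121004).

## The skeleton: R along its Galois-type SECTORS (the decomposition the tree has already certified for R′)

By the classification of finite subgroups of `PGL₂(ℂ)` an irreducible finite-image `σ` has solvable (dihedral,
tetrahedral, octahedral) or icosahedral projective image; an icosahedral `σ` over the quadratic field `K` either is a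
twist `(ρ|_{Γ_K}) ⊗ ψ` of the restriction of a finite-image `ρ : Γ_ℚ → GL₂(ℚ̄_p)` — `ρ` ODD or `ρ` EVEN — or admits no
such twist-descent at all (its `A₅`-field `M` has `Gal(M/ℚ) ≅ S₅` or `M/ℚ` is not normal).  Two of the four sectors
are THEOREMS IN PRINT and are closed in the tree modulo named Literature facts, WITHOUT the `p`-adic hypothesis:

* solvable image — Langlands–Tunnell over any number field (`strongArtin_of_isSolvable`, Gelbart 1997 Thm. 2.1;
  landed `…SolvableSector`, p104572);
* odd twist-descent — Khare–Wintenberger odd Artin over `ℚ` (`khareWintenberger_artinConjecture_of_isOdd`) + Booker 2003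
  (`booker_strongArtin_of_artinConjecture`) + Arthur–Clozel Ch. 3 Thm. 4.2 (a) (`baseChange_cyclic_cuspidal`) + the
  tree's PROVED class field theory / twisting of cuspidal data (landed `…OddBaseChangeSector` p123485,
  `…OddTwistSector` p125348).

The landed composition `Summit.Langlands.Langlands.Theorems.ArtinWeightRealisationLevel.artinWeightRealisation_of_residual_twist_sector :
LT → KW → Booker → AC → R|{¬ solvable ∧ ¬ odd-twist-descent} → R` concludes THIS crux BY NAME.  This file cuts the
residue once more, by excluded middle on "some twist of `σ` descends to a finite-image `ρ` over `ℚ` (of any parity)":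

* `stub_evenTwistIcosahedralSector` — R on the insoluble `σ = (ρ|_{Γ_K}) ⊗ ψ` with `ρ` finite-image and NOT odd
  (the EVEN icosahedral sector: the instance the whole imaginary-quadratic Artin programme is after, Calegari 2023 §12;
  it contains every `σ` the sibling route `ParityBlindBianchi` feeds to R′).  OPEN; the `p`-adic hypothesis is its only
  handle (sibling Disproof.lean §a4);
* `stub_genuineIcosahedralSector` — R on the insoluble `σ` NO twist of which descends to `ℚ` (the genuinely Bianchi
  icosahedral representations).  OPEN; no host known (sibling STRATEGY-CENSUS.md §3, SPLIT.md child G);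
* `stub_strongArtinOfIsSolvable`, `stub_khareWintenbergerOddArtin`, `stub_bookerStrongArtin`,
  `stub_baseChangeCyclicCuspidal` — the four named Literature facts BY NAME (theorems in print; Literature debt, no
  `_holds` in the tree on 2026-08-17; each closes the day its `_holds` lands).

`ArtinWeightRealisation_of` (kernel-checked, no `sorry`; hypotheses = the six stub statements by name via
`_Goal.stub_x := type_of% @stub_x`): the landed residual-twist composition, fed by the case split
(∃ twist-descent ⇒ its `ρ` is not odd, else the residue hypothesis is contradicted ⇒ even sector; else genuine sector).
`lean check`: sorries = the six stubs, nothing else.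

The two open stubs are exactly the a.e. (R-shaped) forms of the children E `ArtinRealisationLevelEvenTwist` and
G `ArtinRealisationLevelGenuine` of the strategist's staged split of the sibling crux R′ (Cruxes/ArtinWeightRealisationLevel/SPLIT.md),
sharpened by the extra antecedent `¬ IsSolvable (projectiveImage σ)` (solvable `σ` are Langlands–Tunnell's) and with the
twist spelt `FramedRep.twist (ρ.restrictField K) ψ = σ` as in the landed sector theorems; so the open content of R and
of R′ is ONE pair of statements up to the Level ⇒ a.e. weakening.

Disproof used: no `Disproof.lean` exists for this crux (`ledger crux ls stmt-Langlands-11057`: Ideas/weight-two-eisenstein-host.md,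
SketchIdeator1.lean only).  The sibling's `Cruxes/ArtinWeightRealisationLevel/Disproof.lean` v1.2 (verdict: no kill possible
short of a counterexample to Artin reciprocity over `K`) is honoured: its §a3/§c findings (irreducibility and finite image
are load-bearing) are kept verbatim in both open stubs, and its §a4 finding (the `IsHeckePoint ∧ IsHeckeAssociatedAt`
package is the only handle) is WHERE the line uses the hypothesis H of the crux — at `stub_evenTwistIcosahedralSector` and
`stub_genuineIcosahedralSector`, which carry H verbatim; the four fact stubs do not need H.  No landed Negative lemma exists
under `Theorems/ArtinWeightRealisation/` (the two under `Theorems/ArtinWeightRealisationLevel/Negative/` concern the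
`S₀ : Finset ℕ` binder of R′, absent from R, whose `S` is a set of places of `K` containing those above `p`).

References: S. Gelbart, Proc. Symp. Pure Math. 61 (1997), Thm. 2.1 [Gelbart1997]; J. Tunnell, BAMS 5 (1981) [Tunnell1981];
C. Khare, J.-P. Wintenberger, Invent. Math. 178 (2009), §10 [KhareWintenberger2009]; A. Booker, Ann. of Math. 158 (2003),
Cor. p. 1090 [Booker2003]; J. Arthur, L. Clozel, Ann. Math. Stud. 120, Ch. 3 Thm. 4.2 (a) [ArthurClozelAMS120];
F. Calegari, ICM 2022 survey §12 [Calegari2023]; K. Buzzard, T. Gee, LMS LNS 414 (2014), Conj. 3.2.2 [BuzzardGeeLMS2014];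
P. Scholze, Ann. of Math. 182 (2015), §V.4 [Scholze2015].
-/

noncomputable section

set_option linter.dupNamespace false -- project-wide option; `Summit.Langlands.Langlands` is the mandated namespace

open scoped NumberField Classical Topology
open Filter IsDedekindDomain
open Literature.NumberTheory.Automorphic Literature.NumberTheory.GaloisRepresentations
open Summit.Langlands
open Summit.Langlands.Langlands.Theses.RuelleTorsionArtinWeight (ArtinWeightRealisation)

namespace Summit.Langlands.Langlands.Cruxes.ArtinWeightRealisation.Birth

/-! ## 1. The six stubs (the ONLY sorries of this file) -/

/-- **stub LT — Langlands–Tunnell over every number field**, the Literature named fact BY NAME: for every irreducible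
`σ : Γ_F → GL₂(ℂ)` of Artin type with SOLVABLE projective image there is a cuspidal `π(σ)` on `GL₂(𝔸_F)` in Tunnell's
a.e. sense (`IsPiOfArtinRep`).  A THEOREM of the literature (Langlands 1980, Tunnell 1981; Gelbart 1997 Thm. 2.1); in the
tree it is reduced to its three type-leaves (`strongArtin_of_isSolvable_of_cases`) and to seven L² leaves
(`strongArtin_of_isSolvable_of_seven_leaves`) but has no `_holds`: Literature debt, size XL.
[cite: Gelbart1997, Thm. 2.1] [cite: Tunnell1981, Theorem (p. 174)] -/
theorem stub_strongArtinOfIsSolvable : Literature.NumberTheory.Automorphic.strongArtin_of_isSolvable := by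
  sorry

/-- **stub KW — Artin's conjecture for odd two-dimensional `ρ : Γ_ℚ → GL₂(ℂ)`**, the Literature named fact BY NAME
(Khare–Wintenberger 2009 §10 with Kisin; in the tree a corollary of the weight-one fact
`khareWintenberger_weightOne_of_isOdd` through the proved Deligne–Serre comparison,
`khareWintenberger_artinConjecture_of_isOdd_of_weightOne`).  A THEOREM of the literature; no `_holds`; size XL.
[cite: KhareWintenberger2009, §10 p. 18 (after Thm. 10.1)] -/
theorem stub_khareWintenbergerOddArtin : Literature.NumberTheory.Automorphic.khareWintenberger_artinConjecture_of_isOdd := by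
  sorry

/-- **stub Booker — Artin ⇒ strong Artin for two-dimensional `ρ` over `ℚ`** (Booker 2003, Corollary p. 1090, either
parity), the Literature named fact BY NAME (tagged `@[conjecture]` in the tree only because its converse-theorem proof is
not vendored; reduced there to Booker–Krishnamurthy / the Langlands lemma, `booker_strongArtin_of_artinConjecture_of_langlandsLemma`).
Used only for ODD `ρ`, where KW supplies the entire continuation (`strongArtin_ae_of_isOdd`).  A THEOREM of the literature;
no `_holds`; size L–XL.  [cite: Booker2003, Corollary (p. 1090)] -/
theorem stub_bookerStrongArtin : Literature.NumberTheory.Automorphic.booker_strongArtin_of_artinConjecture := by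
  sorry

/-- **stub AC — cuspidality of prime-degree cyclic base change** (Arthur–Clozel 1989, Ch. 3, Thm. 4.2 (a)), the
Literature named fact BY NAME; in the tree it is derived from its L² leaves (`baseChange_cyclic_cuspidal_of_leaves`,
`baseChange_cyclic_cuspidal_of_weakLifting`) but has no unconditional `_holds`.  Used for the quadratic base change
`ℚ → K` of `π(ρ)`, `ρ` odd of finite image with `ρ|_{Γ_K}` irreducible.  A THEOREM of the literature; size XL.
[cite: ArthurClozelAMS120, Ch. 3, Thm. 4.2 (a) with Def. 1.1] -/
theorem stub_baseChangeCyclicCuspidal : Literature.NumberTheory.Automorphic.baseChange_cyclic_cuspidal := by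
  sorry

/-- **stub E — the EVEN twist-descent icosahedral sector of R** (OPEN; the famous case).  R verbatim, restricted to the
`σ : Γ_K → GL₂(ℚ̄_p)` with INSOLUBLE projective image that are a twist `(ρ|_{Γ_K}) ⊗ ψ` of the restriction of a
finite-image `ρ : Γ_ℚ → GL₂(ℚ̄_p)` which is NOT odd (so `ρ` is an even icosahedral Artin representation of `Γ_ℚ`), `ψ` a
finite-image character of `Γ_K`: if such a `σ` is `p`-adically automorphic of some `S`-good tame level (the hypothesis H of
the crux, verbatim) then a cuspidal `π` of `GL₂(𝔸_K)` is Satake–Frobenius compatible with `σ` a.e.  This is where the line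
USES H (without it the stub is strong Artin for even icosahedral `ρ` restricted to `K` — open since Klein); it contains the
instance of the sibling route `ParityBlindBianchi` (`σ` = the 2-adic model of `ρ|_{Γ_K}`, `ρ` even icosahedral) and is the
a.e. form of the child E `ArtinRealisationLevelEvenTwist` of the staged split of R′.  Why it might fail: only if strong
Artin fails for an even icosahedral twist over `K`; as a STEP it is classicality of a `p`-adic automorphic eigensystem at
the singular weight over a field with a complex place — no Shimura variety, no weight-one geometry, no
overconvergent-⇒-classical criterion (NonRegularWeightBarrier); admissible hosts under study: the `U(2,2)`
Siegel–Eisenstein / CAP wall at scalar weight 2 (crux idea weight-two-eisenstein-host), even Maass theory of `ρ` over `ℚ`.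
[cite: Calegari2023, §12] [cite: BuzzardGeeLMS2014, Conj. 3.2.2] [cite: Scholze2015, §V.4] -/
theorem stub_evenTwistIcosahedralSector : ∀ (K : Type) [Field K] [NumberField K], NumberField.IsTotallyComplex K → Module.finrank ℚ K = 2 → ∀ (p : ℕ) [Fact p.Prime] (ι : PadicAlgCl p ≃+* ℂ) (σ : Literature.NumberTheory.GaloisRepresentations.FramedGaloisRep K (PadicAlgCl p) 2), Finite σ.toMonoidHom.range → σ.toGaloisRep.IsIrreducible → ¬ IsSolvable (Literature.NumberTheory.GaloisRepresentations.projectiveImage σ.toMonoidHom) → (∃ (ρ : Literature.NumberTheory.GaloisRepresentations.FramedGaloisRep ℚ (PadicAlgCl p) 2) (ψ : Field.absoluteGaloisGroup K →ₜ* (PadicAlgCl p)ˣ), Finite ρ.toMonoidHom.range ∧ ¬ ρ.IsOdd ∧ Finite ψ.toMonoidHom.range ∧ Literature.NumberTheory.GaloisRepresentations.FramedRep.twist (ρ.restrictField K) ψ = σ) → (∃ (S : Finset (IsDedekindDomain.HeightOneSpectrum (NumberField.RingOfIntegers K))) (U : Subgroup (GL (Fin 2) (IsDedekindDomain.FiniteAdeleRing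 (NumberField.RingOfIntegers K) K))) (ϖ : ∀ v : IsDedekindDomain.HeightOneSpectrum (NumberField.RingOfIntegers K), (v.adicCompletion K)ˣ) (a : {v : IsDedekindDomain.HeightOneSpectrum (NumberField.RingOfIntegers K) // v ∉ S} → ℕ → (Valued.v (R := PadicAlgCl p)).valuationSubring), (∀ v : IsDedekindDomain.HeightOneSpectrum (NumberField.RingOfIntegers K), ((p : ℕ) : NumberField.RingOfIntegers K) ∈ v.asIdeal → v ∈ S) ∧ IsOpen (U : Set (GL (Fin 2) (IsDedekindDomain.FiniteAdeleRing (NumberField.RingOfIntegers K) K))) ∧ U ≤ Literature.NumberTheory.Automorphic.glFiniteIntegralLevel 2 K ∧ (∀ g ∈ Literature.NumberTheory.Automorphic.glFiniteIntegralLevel 2 K, (∀ v ∈ S, ∀ i j : Fin 2, ((g : Matrix (Fin 2) (Fin 2) (IsDedekindDomain.FiniteAdeleRing (NumberField.RingOfIntegers K) K)) i j) v = (1 : Matrix (Fin 2) (Fin 2) (v.adicCompletion K)) i j) → g ∈ U) ∧ (∀ v : IsDedekindDomain.HeightOneSpectrum (NumberField.RingOfIntegers K), Valued.v ((ϖ v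 : (v.adicCompletion K)ˣ) : v.adicCompletion K) = WithZero.exp (-1 : ℤ)) ∧ Literature.NumberTheory.Automorphic.IsHeckePoint (Matrix.GeneralLinearGroup.map (n := Fin 2) (algebraMap K (IsDedekindDomain.FiniteAdeleRing (NumberField.RingOfIntegers K) K))) (Literature.NumberTheory.Automorphic.LevelTower.ofSeq U (fun r : ℕ => (Literature.NumberTheory.Automorphic.principalCongruenceLevel 2 K (Ideal.span {((p : ℕ) : NumberField.RingOfIntegers K)} ^ r)).map (Literature.NumberTheory.Automorphic.GLn.sndHom 2 K))) ((p : ℕ) : (Valued.v (R := PadicAlgCl p)).valuationSubring) (fun j : {v : IsDedekindDomain.HeightOneSpectrum (NumberField.RingOfIntegers K) // v ∉ S} × Fin 2 => Literature.NumberTheory.Automorphic.GLn.sndHom 2 K (Literature.NumberTheory.Automorphic.heckeDiagAt 2 K j.1.1 (ϖ j.1.1) (j.2.val + 1))) (fun j => a j.1 (j.2.val + 1)) ∧ ∀ (v : IsDedekindDomain.HeightOneSpectrum (NumberField.RingOfIntegers K)) (hv : v ∉ S), σ.IsHeckeAssociatedAt v (fun i : ℕ => if i = 0 then (1 : PadicAlgCl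 p) else ((a ⟨v, hv⟩ i : (Valued.v (R := PadicAlgCl p)).valuationSubring) : PadicAlgCl p))) → ∃ (hcpt : Literature.NumberTheory.Automorphic.isCompact_glFiniteIntegralLevel 2 K) (π : Literature.NumberTheory.Automorphic.CuspidalAutomorphicRepData 2 K hcpt), ∀ᶠ w : IsDedekindDomain.HeightOneSpectrum (NumberField.RingOfIntegers K) in Filter.cofinite, Summit.Langlands.SatakeFrobCompatibleAt ι π.1 σ w := by
  sorry

/-- **stub G — the GENUINE (non-descending) icosahedral sector of R** (OPEN; the wall proper).  R verbatim, restricted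
to the `σ : Γ_K → GL₂(ℚ̄_p)` with INSOLUBLE projective image NO twist of which is the restriction to `Γ_K` of a
finite-image representation of `Γ_ℚ` (equivalently, by Tate lifting — not used — the `A₅`-field `M` of `σ` has
`Gal(M/ℚ) ≅ S₅` or is not normal over `ℚ`): `p`-adic automorphy of such a `σ` (H verbatim) gives a cuspidal `π` of
`GL₂(𝔸_K)` Satake–Frobenius compatible with `σ` a.e.  USES H (without it: strong Artin for genuinely Bianchi icosahedral
`σ`, open).  The a.e. form of the child G `ArtinRealisationLevelGenuine` of the staged split of R′.  Why it might fail: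
only if reciprocity fails over `K`; as a STEP no host is known at all — `σ ⊕ σ^{c∨}`-type carriers on `U(2,2)`/`GSp₄` are
polarizability-locked or have infinitesimal character with no automorphic vector bundle, and every solvable descent meets
the per-place sign wall (sibling STRATEGY-CENSUS.md §3, barrier notes B1–B4).
[cite: Calegari2023, §12] [cite: BuzzardGeeLMS2014, Conj. 3.2.2] [cite: Scholze2015, §V.4] -/
theorem stub_genuineIcosahedralSector : ∀ (K : Type) [Field K] [NumberField K], NumberField.IsTotallyComplex K → Module.finrank ℚ K = 2 → ∀ (p : ℕ) [Fact p.Prime] (ι : PadicAlgCl p ≃+* ℂ) (σ : Literature.NumberTheory.GaloisRepresentations.FramedGaloisRep K (PadicAlgCl p) 2), Finite σ.toMonoidHom.range → σ.toGaloisRep.IsIrreducible → ¬ IsSolvable (Literature.NumberTheory.GaloisRepresentations.projectiveImage σ.toMonoidHom) → ¬ (∃ (ρ : Literature.NumberTheory.GaloisRepresentations.FramedGaloisRep ℚ (PadicAlgCl p) 2) (ψ : Field.absoluteGaloisGroup K →ₜ* (PadicAlgCl p)ˣ), Finite ρ.toMonoidHom.range ∧ Finite ψ.toMonoidHom.range ∧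 Literature.NumberTheory.GaloisRepresentations.FramedRep.twist (ρ.restrictField K) ψ = σ) → (∃ (S : Finset (IsDedekindDomain.HeightOneSpectrum (NumberField.RingOfIntegers K))) (U : Subgroup (GL (Fin 2) (IsDedekindDomain.FiniteAdeleRing (NumberField.RingOfIntegers K) K))) (ϖ : ∀ v : IsDedekindDomain.HeightOneSpectrum (NumberField.RingOfIntegers K), (v.adicCompletion K)ˣ) (a : {v : IsDedekindDomain.HeightOneSpectrum (NumberField.RingOfIntegers K) // v ∉ S} → ℕ → (Valued.v (R := PadicAlgCl p)).valuationSubring), (∀ v : IsDedekindDomain.HeightOneSpectrum (NumberField.RingOfIntegers K), ((p : ℕ) : NumberField.RingOfIntegers K) ∈ v.asIdeal → v ∈ S) ∧ IsOpen (U : Set (GL (Fin 2) (IsDedekindDomain.FiniteAdeleRing (NumberField.RingOfIntegers K) K))) ∧ U ≤ Literature.NumberTheory.Automorphic.glFiniteIntegralLevel 2 K ∧ (∀ g ∈ Literature.NumberTheory.Automorphic.glFiniteIntegralLevel 2 K, (∀ v ∈ S, ∀ i j : Fin 2, ((g : Matrix (Fin 2) (Fin 2) (IsDedekindDomain.FiniteAdeleRing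 (NumberField.RingOfIntegers K) K)) i j) v = (1 : Matrix (Fin 2) (Fin 2) (v.adicCompletion K)) i j) → g ∈ U) ∧ (∀ v : IsDedekindDomain.HeightOneSpectrum (NumberField.RingOfIntegers K), Valued.v ((ϖ v : (v.adicCompletion K)ˣ) : v.adicCompletion K) = WithZero.exp (-1 : ℤ)) ∧ Literature.NumberTheory.Automorphic.IsHeckePoint (Matrix.GeneralLinearGroup.map (n := Fin 2) (algebraMap K (IsDedekindDomain.FiniteAdeleRing (NumberField.RingOfIntegers K) K))) (Literature.NumberTheory.Automorphic.LevelTower.ofSeq U (fun r : ℕ => (Literature.NumberTheory.Automorphic.principalCongruenceLevel 2 K (Ideal.span {((p : ℕ) : NumberField.RingOfIntegers K)} ^ r)).map (Literature.NumberTheory.Automorphic.GLn.sndHom 2 K))) ((p : ℕ) : (Valued.v (R := PadicAlgCl p)).valuationSubring) (fun j : {v : IsDedekindDomain.HeightOneSpectrum (NumberField.RingOfIntegers K) // v ∉ S} × Fin 2 => Literature.NumberTheory.Automorphic.GLn.sndHom 2 K (Literature.NumberTheory.Automorphic.heckeDiagAt 2 K j.1.1 (ϖ j.1.1) (j.2.val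 + 1))) (fun j => a j.1 (j.2.val + 1)) ∧ ∀ (v : IsDedekindDomain.HeightOneSpectrum (NumberField.RingOfIntegers K)) (hv : v ∉ S), σ.IsHeckeAssociatedAt v (fun i : ℕ => if i = 0 then (1 : PadicAlgCl p) else ((a ⟨v, hv⟩ i : (Valued.v (R := PadicAlgCl p)).valuationSubring) : PadicAlgCl p))) → ∃ (hcpt : Literature.NumberTheory.Automorphic.isCompact_glFiniteIntegralLevel 2 K) (π : Literature.NumberTheory.Automorphic.CuspidalAutomorphicRepData 2 K hcpt), ∀ᶠ w : IsDedekindDomain.HeightOneSpectrum (NumberField.RingOfIntegers K) in Filter.cofinite, Summit.Langlands.SatakeFrobCompatibleAt ι π.1 σ w := by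
  sorry

/-! ## 2. The stub statements as named propositions (hypotheses of the composition, admissible by stub name)

Each `_Goal.stub_x` is `type_of% @stub_x`: literally the stub's statement, no text duplicated, no `sorry` inherited. -/

namespace _Goal

/-- The statement of `stub_strongArtinOfIsSolvable` (literally its type). [folklore] -/
def stub_strongArtinOfIsSolvable : Prop :=
  type_of% @Summit.Langlands.Langlands.Cruxes.ArtinWeightRealisation.Birth.stub_strongArtinOfIsSolvable

/-- The statement of `stub_khareWintenbergerOddArtin` (literally its type). [folklore] -/
def stub_khareWintenbergerOddArtin : Prop :=
  type_of% @Summit.Langlands.Langlands.Cruxes.ArtinWeightRealisation.Birth.stub_khareWintenbergerOddArtin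

/-- The statement of `stub_bookerStrongArtin` (literally its type). [folklore] -/
def stub_bookerStrongArtin : Prop :=
  type_of% @Summit.Langlands.Langlands.Cruxes.ArtinWeightRealisation.Birth.stub_bookerStrongArtin

/-- The statement of `stub_baseChangeCyclicCuspidal` (literally its type). [folklore] -/
def stub_baseChangeCyclicCuspidal : Prop :=
  type_of% @Summit.Langlands.Langlands.Cruxes.ArtinWeightRealisation.Birth.stub_baseChangeCyclicCuspidal

/-- The statement of `stub_evenTwistIcosahedralSector` (literally its type). [folklore] -/
def stub_evenTwistIcosahedralSector : Prop :=
  type_of% @Summit.Langlands.Langlands.Cruxes.ArtinWeightRealisation.Birth.stub_evenTwistIcosahedralSector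

/-- The statement of `stub_genuineIcosahedralSector` (literally its type). [folklore] -/
def stub_genuineIcosahedralSector : Prop :=
  type_of% @Summit.Langlands.Langlands.Cruxes.ArtinWeightRealisation.Birth.stub_genuineIcosahedralSector

end _Goal

/-! ## 3. The composition (kernel-checked, no `sorry`): LT → KW → Booker → AC → E → G → ArtinWeightRealisation -/

/-- **`ArtinWeightRealisation` from its six stubs.**  The landed residual-twist composition
`artinWeightRealisation_of_residual_twist_sector` (LT, KW, Booker, AC discharge the solvable and the odd-twist-descent
sectors) leaves the insoluble `σ` no twist of which descends to an ODD finite-image `ρ` over `ℚ`; by excluded middle on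
"some twist of `σ` descends to SOME finite-image `ρ` over `ℚ`" such a `σ` lies in the even sector (its `ρ` cannot be odd)
or in the genuine sector.  Hypotheses = the six stub statements by name; conclusion = the route decl by name. [folklore] -/
theorem ArtinWeightRealisation_of (hLT : _Goal.stub_strongArtinOfIsSolvable) (hKW : _Goal.stub_khareWintenbergerOddArtin)
    (hB : _Goal.stub_bookerStrongArtin) (hBC : _Goal.stub_baseChangeCyclicCuspidal)
    (hE : _Goal.stub_evenTwistIcosahedralSector) (hG : _Goal.stub_genuineIcosahedralSector) :
    ArtinWeightRealisation := by
  dsimp only [_Goal.stub_strongArtinOfIsSolvable, _Goal.stub_khareWintenbergerOddArtin, _Goal.stub_bookerStrongArtin,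
    _Goal.stub_baseChangeCyclicCuspidal, _Goal.stub_evenTwistIcosahedralSector, _Goal.stub_genuineIcosahedralSector]
    at hLT hKW hB hBC hE hG
  refine Summit.Langlands.Langlands.Theorems.ArtinWeightRealisationLevel.artinWeightRealisation_of_residual_twist_sector
    hLT hKW hB hBC ?_
  intro K _ _ htc hdeg p _ ι σ hfin hirr hs hnodd hyp
  by_cases hdesc : ∃ (ρ : FramedGaloisRep ℚ (PadicAlgCl p) 2) (ψ : Field.absoluteGaloisGroup K →ₜ* (PadicAlgCl p)ˣ),
      Finite ρ.toMonoidHom.range ∧ Finite ψ.toMonoidHom.range ∧ FramedRep.twist (ρ.restrictField K) ψ = σ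
  · obtain ⟨ρ, ψ, hρ, hψ, hσ⟩ := hdesc
    have hev : ¬ ρ.IsOdd := fun hodd => hnodd ⟨ρ, ψ, hρ, hodd, hψ, hσ⟩
    exact hE K htc hdeg p ι σ hfin hirr hs ⟨ρ, ψ, hρ, hev, hψ, hσ⟩ hyp
  · exact hG K htc hdeg p ι σ hfin hirr hs hdesc hyp

/-- By-name sanity check (an `example`, not a declaration): the six stubs feed the composition as they stand. -/
example : ArtinWeightRealisation :=
  ArtinWeightRealisation_of stub_strongArtinOfIsSolvable stub_khareWintenbergerOddArtin stub_bookerStrongArtin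
    stub_baseChangeCyclicCuspidal stub_evenTwistIcosahedralSector stub_genuineIcosahedralSector

end Summit.Langlands.Langlands.Cruxes.ArtinWeightRealisation.Birth

end
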